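import Summits.Langlands.Langlands.Theorems.IrreducibilityBySelfDualityReducibleForcesEssSelfDualStableLine
import Summits.Langlands.Langlands.Theorems.IrreducibilityBySelfDualityReducibleForcesEssSelfDualThreeLines
import Summits.Langlands.Langlands.Theorems.IrreducibilityBySelfDualityReducibleForcesEssSelfDualAnalytic
import Literature.NumberTheory.Automorphic.BockleHuiIrreducibleGL3WeightProofs
import HarnessLib

/-!
# `ReducibleForcesEssSelfDual` (route `IrreducibilityBySelfDuality`, item stmt-Langlands-13619) — PROOF

The support item `ReducibleForcesEssSelfDual` of the route
`Summits/Langlands/Langlands/Theses/IrreducibilityBySelfDuality.lean` (rank 4; Böckle–Hui 2025,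
§3.2.1 made field-independent, with compatibility only at almost all places), proved from its four
inlined inputs — Böckle–Hui Thm. 1.1 in cofinite GL(1) form (`WeakAbelianSummandHecke`), Clozel's
Hecke field (`HeckeEigenvalueField`), Jacquet–Shalika (2.2) for Borel–Jacquet data
(`PairLBoundaryJS`, definitionally the tree's `JacquetShalika1981_partialPairL_boundary_repData`) and
the contragredient datum (`ContragredientDatum`, definitionally
`CuspidalAutomorphicRepData.exists_contragredient_satake`) — for EVERY number field `K`:

for `π` regular algebraic cuspidal on `GL_3(𝔸_K)`, `ℓ`, `ι`, and `r : Γ_K → GL_3(ℚ̄_ℓ)` semisimple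
and compatible with `(π, ι)` at almost all places (C-normalisation `arithFrobPolyOfSatake ι q_v 3`),
(1) if `r` is NOT irreducible then `π` is essentially self-dual at Satake level (a cuspidal GL(1)
datum `η` with `t_{π,v}⁻¹ = η(ϖ_v) t_{π,v}` a.e.), and (2) `r` never has three linearly independent
stable lines.

The theorem `reducibleForcesEssSelfDual_of` is stated as the route text VERBATIM (this module does
not import the Theses file, so that the gate can link `ReducibleForcesEssSelfDual_holds` to it
without an import cycle — kill criterion (e) of the route); it is definitionally the route decl
`Summit.Langlands.Langlands.Theses.IrreducibilityBySelfDuality.ReducibleForcesEssSelfDual`.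

## Proof (Böckle–Hui §3.2.1, cofinite and over any number field)

* Clozel's Hecke field `E ⊆ ℂ` (input) is a number field; by
  `eventually_rational_of_heckeEigenvalue_mem` (helper file `…StableLine`) `r` is `E`-rational at
  almost all places for `ι⁻¹|_E`, and the character `τ` of any `r`-stable line weakly divides `r`
  cofinitely (`eventually_weaklyDivides_of_stableLine`); so Böckle–Hui's Thm. 1.1 (input, GL(1)
  form) attaches to `τ` a cuspidal GL(1) datum `χ` with `τ(Frob_v) = ι⁻¹(c_v⁻¹)`, `{c_v}` the
  Satake parameter of `χ`, a.e.
* (1) A reducible semisimple `r` has a stable line (`exists_stableLine_of_not_isIrreducible`, tree);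
  the Hecke character `μ = χ‖·‖` has `μ(ϖ_v) ∈ t_{π,v}` a.e.
  (`exists_heckeCharacter_mem_satake_of_glOne`: `c_v = q_v a_v`); the analytic case PROVED in the
  tree for any number field (`prod_satake_eq_cube_of_JS'`, from (2.2) and the contragredient) gives
  `∏ t_{π,v} = μ(ϖ_v)³` a.e.; then `t_{π,v}⁻¹ = μ(ϖ_v)⁻² t_{π,v}` (`map_inv_eq_map_mul_of_prod_eq_cube`)
  and `η = μ⁻²` as a GL(1) datum (`exists_cuspidal_glOne_hasSatakeParamAt_valueAtUniformizer`).
* (2) Three independent stable lines give three characters `τ_i`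
  (`FramedRep.exists_rankOne_of_stableLine`), three GL(1) data `χ_i`, and
  `t_{π,v} = {μ₀, μ₁, μ₂}(ϖ_v)` a.e. (`exists_heckeCharacters_satake_eq_of_three_glOne`, helper file
  `…ThreeLines`); this contradicts cuspidality by the pole count
  `L^S(s, π₀ × θ₀⁻¹) = ζ_F^S(s) L^S(s, θ₁/θ₀) L^S(s, θ₂/θ₀)`
  (`false_of_satake_eq_three_heckeCharacters`, helper file `…Analytic`).

References: G. Böckle, C.-Y. Hui, Math. Ann. 393 (2025), Thm. 1.1, §3.1, §3.2.1
(arXiv:2404.08954, p. 13); L. Clozel, *Motifs et formes automorphes* (1990), Thm. 3.13; J. Arthur,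
L. Clozel, Ann. of Math. Stud. 120, Ch. 3 §2 (2.2); H. Jacquet, J. Shalika, Amer. J. Math. 103 (1981).
-/

noncomputable section

set_option linter.dupNamespace false -- project-wide option (lakefile weak.linter.dupNamespace); `Summit.Langlands.Langlands` is the mandated namespace

open scoped NumberField Matrix Polynomial Classical Topology
open NumberField IsDedekindDomain Field Polynomial Filter
open Literature.NumberTheory.Automorphic Literature.NumberTheory.GaloisRepresentations

namespace Summit.Langlands.Langlands.Theorems.ReducibleForcesEssSelfDual

section Bookkeeping

variable {F : Type} [Field F] [NumberField F]

/-- `(χ₁ χ₂)(ϖ_v) = χ₁(ϖ_v) χ₂(ϖ_v)`. [folklore] -/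
private theorem f_vAU_mul (χ₁ χ₂ : HeckeCharacter F) (v : HeightOneSpectrum (𝓞 F)) :
    (χ₁ * χ₂).valueAtUniformizer v = χ₁.valueAtUniformizer v * χ₂.valueAtUniformizer v := by
  simp only [HeckeCharacter.valueAtUniformizer, HeckeCharacter.localComponent_apply,
    HeckeCharacter.mul_apply, Units.val_mul]

/-- `χ⁻¹(ϖ_v) = χ(ϖ_v)⁻¹`. [folklore] -/
private theorem f_vAU_inv (χ : HeckeCharacter F) (v : HeightOneSpectrum (𝓞 F)) :
    χ⁻¹.valueAtUniformizer v = (χ.valueAtUniformizer v)⁻¹ := by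
  simp only [HeckeCharacter.valueAtUniformizer, HeckeCharacter.localComponent_apply,
    HeckeCharacter.inv_apply, Units.val_inv_eq_inv_val]

/-- `χ(ϖ_v) ≠ 0`. [folklore] -/
private theorem f_vAU_ne_zero (χ : HeckeCharacter F) (v : HeightOneSpectrum (𝓞 F)) :
    χ.valueAtUniformizer v ≠ 0 := by
  simp only [HeckeCharacter.valueAtUniformizer, HeckeCharacter.localComponent_apply]
  exact Units.ne_zero _

end Bookkeeping

/-- **`ReducibleForcesEssSelfDual` holds** (item stmt-Langlands-13619 of route `IrreducibilityBySelfDuality`;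
Böckle–Hui 2025 §3.2.1 made field-independent and cofinite).  GIVEN (as antecedents, VERBATIM the
route's input items) Böckle–Hui Thm. 1.1 in cofinite GL(1) form, Clozel's Hecke field, Jacquet–Shalika
(2.2) for Borel–Jacquet data and the contragredient datum: for every number field `K`, level
witnesses `h1`, `hcpt`, `π` regular algebraic cuspidal on `GL_3(𝔸_K)`, `ℓ`, `ι`, and `r`
semisimple, compatible with `(π, ι)` at almost all places in the C-normalisation —
(1) `¬ r` irreducible ⇒ `π` essentially self-dual at Satake level (GL(1) datum `η`, a.e.
`t_{π,v}⁻¹ = η(ϖ_v) · t_{π,v}`); (2) `r` has no three linearly independent stable lines.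
The type is the route text verbatim (definitionally the route decl
`Summit.Langlands.Langlands.Theses.IrreducibilityBySelfDuality.ReducibleForcesEssSelfDual`); proof in
the module docstring. [cite: BockleHui2025, §3.2.1] -/
theorem reducibleForcesEssSelfDual_of :
    (∀ (K : Type) [Field K] [NumberField K] (h1 : _) (ℓ : ℕ) [Fact ℓ.Prime] (n : ℕ) (E : Type) [Field E] [NumberField E] (e : E →+* PadicAlgCl ℓ) (ρ : Literature.NumberTheory.GaloisRepresentations.FramedGaloisRep K (PadicAlgCl ℓ) n), ρ.toGaloisRep.IsSemisimple → (∀ᶠ v in cofinite, ρ.IsUnramifiedAt v ∧ ∃ P : Polynomial E, ρ.HasFrobCharpolyAt v (P.map e)) → ∀ (ψ : Literature.NumberTheory.GaloisRepresentations.FramedGaloisRep K (PadicAlgCl ℓ) 1), (∀ᶠ v in cofinite, ρ.IsUnramifiedAt v ∧ ψ.IsUnramifiedAt v ∧ ∀ 𝔓 ∈ v.primesAbove, ∀ σ : Field.absoluteGaloisGroup K, IsArithFrobAt (NumberField.RingOfIntegers K) σ 𝔓 → ψ.charpoly σ ∣ ρ.charpoly σ) → ∀ (ι : PadicAlgCl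 ℓ ≃+* ℂ), ∃ χ : Literature.NumberTheory.Automorphic.CuspidalAutomorphicRepData 1 K h1, χ.1.IsRegularAlgebraic ∧ ∀ᶠ v in cofinite, ∃ c : ℂ, χ.1.HasSatakeParamAt v {c} ∧ ψ.IsUnramifiedAt v ∧ ψ.HasFrobCharpolyAt v (Literature.NumberTheory.Automorphic.arithFrobPolyOfSatake ι v.residueCard 1 {c})) → (∀ (n : ℕ) (K : Type) [Field K] [NumberField K] (hcpt : _) (π : Literature.NumberTheory.Automorphic.CuspidalAutomorphicRepData n K hcpt), π.1.IsRegularAlgebraic → ∃ E : Subfield ℂ, FiniteDimensional ℚ E ∧ ∀ᶠ v in cofinite, ∀ α : Multiset ℂ, π.1.HasSatakeParamAt v α → ∀ i ≤ n, ((((Real.sqrt (v.residueCard : ℝ)) : ℝ) : ℂ) ^ (i * (n - i))) * α.esymm i ∈ E) → (∀ (n m : ℕ) (F : Type) [Field F] [NumberField F] (hF : _) (hF' : _), 0 < n → 0 < m → ∀ (π : Literature.NumberTheory.Automorphic.CuspidalAutomorphicRepData n F hF) (π' : Literature.NumberTheory.Automorphic.CuspidalAutomorphicRepData m F hF'), ∃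 S₀ : Set (IsDedekindDomain.HeightOneSpectrum (NumberField.RingOfIntegers F)), S₀.Finite ∧ ∀ {S : Set (IsDedekindDomain.HeightOneSpectrum (NumberField.RingOfIntegers F))}, S.Finite → S₀ ⊆ S → ∀ {α β : IsDedekindDomain.HeightOneSpectrum (NumberField.RingOfIntegers F) → Multiset ℂ}, (∀ w ∉ S, π.1.HasSatakeParamAt w (α w)) → (∀ w ∉ S, π'.1.HasSatakeParamAt w (β w)) → (∀ w ∉ S, ‖(α w).prod‖ = 1) → (∀ w ∉ S, ‖(β w).prod‖ = 1) → ∀ {s₀ : ℂ}, s₀.re = 1 → ¬ (n = m ∧ ∀ᶠ w in cofinite, (α w).map ((((w.residueCard : ℂ) ^ (1 - s₀))) * ·) = (β w).map (·⁻¹)) → ∃ c : ℂ, c ≠ 0 ∧ Tendsto (fun s : ℂ => ∏' w : {w : IsDedekindDomain.HeightOneSpectrum (NumberField.RingOfIntegers F) // w ∉ S}, ((Literature.NumberTheory.Automorphic.satakePairPolynomial (α w.1) (β w.1)).eval ((w.1.residueCard : ℂ) ^ (-s)))⁻¹) (𝓝[{s : ℂ | 1 < s.re}] s₀) (𝓝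 c)) → (∀ (n : ℕ) (K : Type) [Field K] [NumberField K] (hcpt : Literature.NumberTheory.Automorphic.isCompact_glFiniteIntegralLevel n K) (π : Literature.NumberTheory.Automorphic.CuspidalAutomorphicRepData n K hcpt), ∃ π' : Literature.NumberTheory.Automorphic.CuspidalAutomorphicRepData n K hcpt, ∀ (v : IsDedekindDomain.HeightOneSpectrum (NumberField.RingOfIntegers K)) (α : Multiset ℂ), π.1.HasSatakeParamAt v α → π'.1.HasSatakeParamAt v (α.map (·⁻¹))) → ∀ (K : Type) [Field K] [NumberField K] (h1 : _) (hcpt : _) (π : Literature.NumberTheory.Automorphic.CuspidalAutomorphicRepData 3 K hcpt), π.1.IsRegularAlgebraic → ∀ (ℓ : ℕ) [Fact ℓ.Prime] (ι : PadicAlgCl ℓ ≃+* ℂ) (r : Literature.NumberTheory.GaloisRepresentations.FramedGaloisRep K (PadicAlgCl ℓ) 3), r.toGaloisRep.IsSemisimple → (∀ᶠ v in cofinite, ∀ α : Multiset ℂ, π.1.HasSatakeParamAt v α → r.IsUnramifiedAt v ∧ r.HasFrobCharpolyAt v (Literature.NumberTheory.Automorphic.arithFrobPolyOfSatake ι v.residueCard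 3 α)) → (¬ r.toGaloisRep.IsIrreducible → (∃ η : Literature.NumberTheory.Automorphic.CuspidalAutomorphicRepData 1 K h1, ∀ᶠ v in cofinite, ∀ α : Multiset ℂ, π.1.HasSatakeParamAt v α → ∃ e : ℂ, η.1.HasSatakeParamAt v {e} ∧ α.map (fun a => a⁻¹) = α.map (fun a => e * a))) ∧ ¬ (∃ x : Fin 3 → (Fin 3 → PadicAlgCl ℓ), LinearIndependent (PadicAlgCl ℓ) x ∧ ∀ (i : Fin 3) (g : Field.absoluteGaloisGroup K), ∃ c : PadicAlgCl ℓ, r.toGaloisRep g (x i) = c • x i) := by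
  intro hA hB hC hD K _ _ h1 hcpt π hπ ℓ _ ι r hss hr
  have hJ2 : JacquetShalika1981_partialPairL_boundary_repData := hC
  have hCon : CuspidalAutomorphicRepData.exists_contragredient_satake hcpt := hD 3 K hcpt
  -- Clozel's Hecke field, a number field; `E`-rationality of `r` a.e. for `ι⁻¹|_E`
  obtain ⟨E, hfd, hE⟩ := hB 3 K hcpt π hπ
  haveI : FiniteDimensional ℚ E := hfd
  haveI : NumberField E := NumberField.mk
  have hrat := eventually_rational_of_heckeEigenvalue_mem π.1 ι r hr E hE
  -- Böckle–Hui Thm 1.1 (GL(1) form) for the character of ANY stable line of `r`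
  have hline : ∀ (τ : FramedGaloisRep K (PadicAlgCl ℓ) 1) (x : Fin 3 → PadicAlgCl ℓ), x ≠ 0 →
      (∀ g : absoluteGaloisGroup K, r.toGaloisRep g x =
        ((Matrix.GeneralLinearGroup.det (τ g) : (PadicAlgCl ℓ)ˣ) : PadicAlgCl ℓ) • x) →
      ∃ χ : CuspidalAutomorphicRepData 1 K h1, ∀ᶠ v : HeightOneSpectrum (𝓞 K) in cofinite,
        ∃ c : ℂ, χ.1.HasSatakeParamAt v {c} ∧ τ.IsUnramifiedAt v ∧
          τ.HasFrobCharpolyAt v (arithFrobPolyOfSatake ι v.residueCard 1 {c}) := by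
    intro τ x hx0 hx
    obtain ⟨χ, -, hχ⟩ := hA K h1 ℓ 3 E ((ι.symm : ℂ ≃+* PadicAlgCl ℓ).toRingHom.comp E.subtype) r
      hss hrat τ (eventually_weaklyDivides_of_stableLine π.1 ι r hr hx0 hx) ι
    exact ⟨χ, hχ⟩
  refine ⟨fun hirr => ?_, ?_⟩
  · -- (1) reducible ⇒ essentially self-dual at Satake level
    obtain ⟨τ, x, hx0, hx⟩ := FramedGaloisRep.exists_stableLine_of_not_isIrreducible r hss hirr
    obtain ⟨χ, hχ⟩ := hline τ x hx0 hx
    obtain ⟨μ, hμ⟩ := exists_heckeCharacter_mem_satake_of_glOne π.1 ι r hr hx0 hx χ hχ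
    have hcube := prod_satake_eq_cube_of_JS' hJ2 hCon π hμ
    obtain ⟨η, hη⟩ := exists_cuspidal_glOne_hasSatakeParamAt_valueAtUniformizer h1 (μ * μ)⁻¹
    refine ⟨η, ?_⟩
    filter_upwards [hμ, hcube, hη] with v hμv hcv hηv α hα
    refine ⟨_, hηv, ?_⟩
    rw [f_vAU_inv, f_vAU_mul, ← pow_two]
    exact map_inv_eq_map_mul_of_prod_eq_cube hα.card_eq (f_vAU_ne_zero μ v) (hμv α hα) (hcv α hα)
  · -- (2) no three linearly independent stable lines
    rintro ⟨x, hli, hx⟩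
    have hx0 : ∀ i, x i ≠ 0 := fun i => hli.ne_zero i
    choose τ hτ using fun i => FramedRep.exists_rankOne_of_stableLine r (hx0 i) (hx i)
    have hτ' : ∀ (i : Fin 3) (g : absoluteGaloisGroup K), r.toGaloisRep g (x i) =
        ((Matrix.GeneralLinearGroup.det (τ i g) : (PadicAlgCl ℓ)ˣ) : PadicAlgCl ℓ) • x i := hτ
    choose χ hχ using fun i => hline (τ i) (x i) (hx0 i) (hτ' i)
    obtain ⟨μ, hμ⟩ := exists_heckeCharacters_satake_eq_of_three_glOne π.1 ι r hr hli hτ' χ hχ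
    refine false_of_satake_eq_three_heckeCharacters hJ2 hCon π (μ 0) (μ 1) (μ 2) ?_
    filter_upwards [hμ] with v hv α hα
    rw [hv α hα]
    rfl

end Summit.Langlands.Langlands.Theorems.ReducibleForcesEssSelfDual

end
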